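import Mathlib
import Literature.NumberTheory.Sieve.LiouvillePolynomialValues
import Literature.NumberTheory.Sieve.LiouvillePolynomialValuesProofs
import Literature.NumberTheory.LFunctions.TaoLogElliottHolds
import Literature.NumberTheory.LFunctions.LiouvilleNonpretentious
import HarnessLib

/-!
# The Liouville function at polynomial arguments — proofs, II
# (densities, the reduction of Corollary 2.1 to Theorem 2.6, and the unconditional case `deg P ≤ 2`)

Second sibling of `Literature/NumberTheory/Sieve/LiouvillePolynomialValues.lean` (J. Teräväinen,
*On the Liouville function at polynomial arguments*, Amer. J. Math. 146 (2024) 1115–1167 =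
arXiv:2010.07924, `Teravainen2024`), continuing `LiouvillePolynomialValuesProofs.lean` (the
algebraic structure lemma `exists_linearForms_of_isNonSquarePoly`).  Everything here is PROVED;
no definition, no named fact (D-0026).  The file supports — but does NOT discharge — the named fact
`teravainen2024_cor_2_1` (Corollary 2.1).

## Contents

* `log_sub_log_le_sum_Ioc_inv` — `log(N+1) − log(M+1) ≤ ∑_{M<n≤N} 1/n` [folklore].
* `card_filter_ge_of_window_bound` — for `f : ℕ → {±1}`, a log-window bound
  `|∑_{x/ω<n≤x} f(n)/n| ≤ ¼ log ω` (`4 ≤ ω ≤ x`) forces each sign to be taken `≥ x/(8ω)` times on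
  `[1, x]` (the transfer "it suffices to prove [the log-window bound] for some constants `η > 0`
  and `ω`" of §5.1 of the paper, crude form);
  `abs_sum_le_of_card_filter_ge` — both signs with density `η` ⟹ `|∑_{n≤x} f| ≤ (1−2η)x`.
* `teravainen2024_cor_2_1_of_correlationBound` — **the reduction**: if Theorem 2.6 holds for
  `g_j = λ` and all `k ≤ K` forms (rendered `ε`-free: `∃ δ > 0`, eventually
  `|∑_{n≤x} ∏ λ(aᵢn+bᵢ)| ≤ (1−δ)x`), then Corollary 2.1 holds for every non-square `P` of degree
  `≤ K` splitting over `ℚ`; `teravainen2024_cor_2_1_of_thm_2_6_liouville` — all `K`: Theorem 2.6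
  for `λ` ⟹ `teravainen2024_cor_2_1` (the printed derivation "Corollary 2.1 follows as a special
  case", §2.1, made explicit; Theorem 2.6 itself is NOT in the tree).
* `liouville_window_bound` — Tao 2016, Theorem 1.3 for `g₁ = λ`, `ε = ¼`, fixed `ω`
  (`LFunctions.tao_log_averaged_elliott_two_holds` + `LFunctions.Tao2016_liouvilleNonpretentious_holds`);
  `liouville_correlationBound_one/two/_of_le_two` — the cases `k ≤ 2` of Theorem 2.6 for `λ`,
  unconditionally.
* `teravainen2024_cor_2_1_of_natDegree_le_two` — **Corollary 2.1 for `deg P ≤ 2`, PROVED**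
  (axioms `propext`, `Classical.choice`, `Quot.sound`).
* `norm_sum_le_of_logWindow_le` — the first reduction of §5.1 of the paper in general form
  (`1`-bounded complex `F`): a log-window mean `≤ 1 − η` in modulus (`8 ≤ ω ≤ x`) forces the natural
  mean `‖(1/x)∑_{n≤x} F(n)‖ ≤ 1 − η/ω` — the brick through which any future proof of Theorem 2.6
  (whose §5 argument bounds log-window means) feeds `teravainen2024_cor_2_1_of_correlationBound`.

## What is NOT here

Theorem 2.6 for `k ≥ 3` (§5 of the paper: Tao's entropy decrement argument in `k`-point form, the
Green–Tao dense model theorem and generalized von Neumann theorem with the `W`-tricked von Mangoldt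
majorant, the 99% inverse theorem along progressions Prop. 5.3, and Prop. 5.4 on `μ_q`-valued
sequences versus polynomial phases via Matomäki–Radziwiłł).  For `k = 3` the tree's
`Sieve.liouville_logCorrelation_isLittleO_of_odd` (Tao–Teräväinen, odd `k`; itself an undischarged
fact) would not suffice either: it is the full-sum `o(log x)` form, which does not control windows
`x/ω < n ≤ x` of bounded `ω` and hence gives no natural lower density.

## References
* J. Teräväinen, Amer. J. Math. 146 (2024) 1115–1167; arXiv:2010.07924: Corollary 2.1, Theorem 2.6,
  §5.1 (first paragraph). [Teravainen2024]
* T. Tao, Forum Math. Pi 4 (2016), e8: Theorem 1.3, Corollary 1.5. [TaoFMP2016]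
-/

namespace Literature.NumberTheory.Sieve

open Polynomial Finset


section Analytic

open Real Filter

/-! ### A harmonic tail bound -/

/-- `log(N+1) − log(M+1) ≤ ∑_{M<n≤N} 1/n` (from `log t ≤ t − 1`). [folklore] -/
theorem log_sub_log_le_sum_Ioc_inv {M N : ℕ} (h : M ≤ N) :
    Real.log ((N : ℝ) + 1) - Real.log ((M : ℝ) + 1) ≤ ∑ n ∈ Ioc M N, (1 : ℝ) / n := by
  induction N, h using Nat.le_induction with
  | base => simp
  | succ N hMN ih =>
    rw [sum_Ioc_succ_top hMN]
    have hpos : (0 : ℝ) < (N : ℝ) + 1 := by positivity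
    have step : Real.log ((N : ℝ) + 1 + 1) - Real.log ((N : ℝ) + 1) ≤ 1 / ((N : ℝ) + 1) := by
      rw [← Real.log_div (by positivity) hpos.ne']
      have := Real.log_le_sub_one_of_pos (x := ((N : ℝ) + 1 + 1) / ((N : ℝ) + 1)) (by positivity)
      calc _ ≤ ((N : ℝ) + 1 + 1) / ((N : ℝ) + 1) - 1 := this
        _ = 1 / ((N : ℝ) + 1) := by field_simp; ring
    push_cast
    linarith [ih, step]

/-! ### ±1-valued sequences: window bound ⟹ density of each sign ⟹ 99% mean bound -/

/-- A `±1`-valued `f` with `f n ≠ v` has `f n = -v`. [folklore] -/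
theorem eq_neg_of_ne_of_sign {a v : ℤ} (ha : a = 1 ∨ a = -1) (hv : v = 1 ∨ v = -1) (h : a ≠ v) :
    a = -v := by
  rcases ha with rfl | rfl <;> rcases hv with rfl | rfl <;> simp_all

/-- **Log-window bound ⟹ positive density of each sign** (the transfer "it suffices to prove
[the log-window bound] for some constants `η > 0` and `ω`" of Teräväinen 2024, §5.1, first
paragraph, in the crude form needed here). If `f : ℕ → {±1}` satisfies
`|∑_{x/ω<n≤x} f(n)/n| ≤ ¼ log ω` for some `4 ≤ ω ≤ x`, then each sign `v` is taken by at least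
`x/(8ω)` of the `n ≤ x`: otherwise the window sum is
`−v·H + O(#E·ω/x)` with `H = ∑_{x/ω<n≤x} 1/n ≥ log(ω/2)`, which exceeds `¼ log ω` in size
because `log 2 > 1/2`.
[cite: Teravainen2024, §5.1 (first paragraph: reduction to the logarithmic window bound)] -/
theorem card_filter_ge_of_window_bound {f : ℕ → ℤ} (hf : ∀ n, 1 ≤ n → f n = 1 ∨ f n = -1)
    {ω : ℝ} (hω : 4 ≤ ω) {x : ℕ} (hωx : ω ≤ x)
    (hwin : |∑ n ∈ Ioc ⌊(x : ℝ) / ω⌋₊ x, (f n : ℝ) / n| ≤ (1 / 4) * Real.log ω)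
    {v : ℤ} (hv : v = 1 ∨ v = -1) :
    (x : ℝ) / (8 * ω) ≤ ((Icc 1 x).filter (fun n => f n = v)).card := by
  by_contra hlt
  push Not at hlt
  set M := ⌊(x : ℝ) / ω⌋₊ with hM
  have hω0 : (0 : ℝ) < ω := by linarith
  have hx0 : (0 : ℝ) < x := by linarith
  have hMlt : (x : ℝ) / ω < (M : ℝ) + 1 := Nat.lt_floor_add_one _
  have hMle : (M : ℝ) ≤ (x : ℝ) / ω := Nat.floor_le (by positivity)
  have hMx : M ≤ x := by
    have : (M : ℝ) ≤ x := hMle.trans (div_le_self hx0.le (by linarith))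
    exact_mod_cast this
  have hvR : ((v : ℝ)) ^ 2 = 1 := by rcases hv with rfl | rfl <;> norm_num
  -- decomposition of the window sum
  have hdecomp : ∑ n ∈ Ioc M x, (f n : ℝ) / n
      = -(v : ℝ) * ∑ n ∈ Ioc M x, (1 : ℝ) / n
        + 2 * v * ∑ n ∈ (Ioc M x).filter (fun n => f n = v), (1 : ℝ) / n := by
    have hpt : ∀ n ∈ Ioc M x, (f n : ℝ) / n
        = -(v : ℝ) * ((1 : ℝ) / n) + (if f n = v then 2 * (v : ℝ) * ((1 : ℝ) / n) else 0) := by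
      intro n hn
      have hn1 : 1 ≤ n := Nat.succ_le_of_lt (lt_of_le_of_lt (Nat.zero_le _) (mem_Ioc.1 hn).1)
      split_ifs with hfv
      · rw [hfv]; ring
      · rw [eq_neg_of_ne_of_sign (hf n hn1) hv hfv]; push_cast; ring
    rw [sum_congr rfl hpt, sum_add_distrib, ← mul_sum, sum_ite, sum_const_zero, add_zero,
      ← mul_sum]
  -- the exceptional part is small
  have hEcard : (((Ioc M x).filter (fun n => f n = v)).card : ℝ)
      ≤ ((Icc 1 x).filter (fun n => f n = v)).card := by
    have hsub : (Ioc M x).filter (fun n => f n = v) ⊆ (Icc 1 x).filter (fun n => f n = v) := by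
      apply filter_subset_filter
      intro n hn
      rw [mem_Ioc] at hn
      exact mem_Icc.2 ⟨by omega, hn.2⟩
    exact_mod_cast card_le_card hsub
  have hEsum : ∑ n ∈ (Ioc M x).filter (fun n => f n = v), (1 : ℝ) / n
      ≤ ((Ioc M x).filter (fun n => f n = v)).card * (1 / ((M : ℝ) + 1)) := by
    rw [← nsmul_eq_mul]
    apply sum_le_card_nsmul
    intro n hn
    have hn' : M + 1 ≤ n := (mem_Ioc.1 (mem_filter.1 hn).1).1
    have : (M : ℝ) + 1 ≤ n := by exact_mod_cast hn'
    exact one_div_le_one_div_of_le (by positivity) this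
  have hEsmall : ∑ n ∈ (Ioc M x).filter (fun n => f n = v), (1 : ℝ) / n < 1 / 8 := by
    have h1 : 1 / ((M : ℝ) + 1) < ω / x := by
      rw [div_lt_div_iff₀ (by positivity) hx0]
      rw [div_lt_iff₀ hω0] at hMlt
      linarith
    calc ∑ n ∈ (Ioc M x).filter (fun n => f n = v), (1 : ℝ) / n
        ≤ ((Ioc M x).filter (fun n => f n = v)).card * (1 / ((M : ℝ) + 1)) := hEsum
      _ ≤ ((Icc 1 x).filter (fun n => f n = v)).card * (1 / ((M : ℝ) + 1)) := by gcongr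
      _ < (x : ℝ) / (8 * ω) * (ω / x) := by
          apply mul_lt_mul'' hlt h1 (by positivity) (by positivity)
      _ = 1 / 8 := by field_simp
  have hEnn : 0 ≤ ∑ n ∈ (Ioc M x).filter (fun n => f n = v), (1 : ℝ) / n :=
    sum_nonneg fun n _ => by positivity
  -- the harmonic part is large
  have hH : Real.log ω - Real.log 2 ≤ ∑ n ∈ Ioc M x, (1 : ℝ) / n := by
    have h1 := log_sub_log_le_sum_Ioc_inv hMx
    have h2 : Real.log ω - Real.log 2 ≤ Real.log ((x : ℝ) + 1) - Real.log ((M : ℝ) + 1) := by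
      rw [← Real.log_div (by linarith) (by norm_num), ← Real.log_div (by positivity) (by positivity)]
      apply Real.log_le_log (by positivity)
      rw [div_le_div_iff₀ (by norm_num) (by positivity)]
      have : ω * ((M : ℝ) + 1) ≤ x + ω := by
        have := mul_le_mul_of_nonneg_left hMle hω0.le
        rw [mul_div_cancel₀ _ hω0.ne'] at this
        linarith
      nlinarith
    linarith
  -- `log 2 > 1/2` and `log ω ≥ 2 log 2`
  have hlog2 : (1 : ℝ) / 2 < Real.log 2 := by
    have := Real.log_two_gt_d9; norm_num at this ⊢; linarith
  have hlogω : 2 * Real.log 2 ≤ Real.log ω := by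
    rw [← Real.log_rpow (by norm_num)]
    exact Real.log_le_log (by positivity) (by norm_num; linarith)
  -- conclude
  have hbig : Real.log ω - Real.log 2 - 1 / 4 ≤ |∑ n ∈ Ioc M x, (f n : ℝ) / n| := by
    rw [hdecomp]
    have hvabs : |(v : ℝ)| = 1 := by rcases hv with rfl | rfl <;> norm_num
    calc Real.log ω - Real.log 2 - 1 / 4
        ≤ (∑ n ∈ Ioc M x, (1 : ℝ) / n) - 2 * ∑ n ∈ (Ioc M x).filter (fun n => f n = v), (1 : ℝ) / n := by
          linarith
      _ = |-(v : ℝ) * ∑ n ∈ Ioc M x, (1 : ℝ) / n|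
            - |2 * (v : ℝ) * ∑ n ∈ (Ioc M x).filter (fun n => f n = v), (1 : ℝ) / n| := by
          rw [abs_mul, abs_mul, abs_neg, hvabs, one_mul, abs_mul, hvabs,
            abs_of_nonneg (sum_nonneg fun n _ => by positivity), abs_of_nonneg hEnn]
          norm_num
      _ ≤ |-(v : ℝ) * ∑ n ∈ Ioc M x, (1 : ℝ) / n
            + 2 * (v : ℝ) * ∑ n ∈ (Ioc M x).filter (fun n => f n = v), (1 : ℝ) / n| :=
          by
            have := abs_sub_abs_le_abs_sub (-(v : ℝ) * ∑ n ∈ Ioc M x, (1 : ℝ) / n)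
              (-(2 * (v : ℝ) * ∑ n ∈ (Ioc M x).filter (fun n => f n = v), (1 : ℝ) / n))
            rw [abs_neg, sub_neg_eq_add] at this
            exact this
  have := hbig.trans hwin
  nlinarith

/-- **Density of both signs ⟹ 99% mean bound.** If a `±1`-valued `f` takes each sign at least
`η x` times on `[1, x]`, then `|∑_{n≤x} f(n)| ≤ (1 − 2η) x`. [folklore] -/
theorem abs_sum_le_of_card_filter_ge {f : ℕ → ℤ} (hf : ∀ n, 1 ≤ n → f n = 1 ∨ f n = -1)
    {x : ℕ} {η : ℝ} (hplus : η * x ≤ ((Icc 1 x).filter (fun n => f n = 1)).card)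
    (hminus : η * x ≤ ((Icc 1 x).filter (fun n => f n = -1)).card) :
    |∑ n ∈ Icc 1 x, (f n : ℝ)| ≤ (1 - 2 * η) * x := by
  have hsplit := sum_filter_add_sum_filter_not (Icc 1 x) (fun n => f n = 1) (fun n => (f n : ℝ))
  have h1 : ∑ n ∈ (Icc 1 x).filter (fun n => f n = 1), (f n : ℝ)
      = ((Icc 1 x).filter (fun n => f n = 1)).card := by
    rw [card_eq_sum_ones, Nat.cast_sum, Nat.cast_one]
    exact sum_congr rfl fun n hn => by rw [(mem_filter.1 hn).2]; simp
  have hneg : (Icc 1 x).filter (fun n => ¬ f n = 1) = (Icc 1 x).filter (fun n => f n = -1) := by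
    apply filter_congr
    intro n hn
    have hn1 : 1 ≤ n := (mem_Icc.1 hn).1
    constructor
    · exact eq_neg_of_ne_of_sign (hf n hn1) (Or.inl rfl)
    · intro h; rw [h]; decide
  have h2 : ∑ n ∈ (Icc 1 x).filter (fun n => ¬ f n = 1), (f n : ℝ)
      = -(((Icc 1 x).filter (fun n => f n = -1)).card : ℝ) := by
    rw [hneg, card_eq_sum_ones, Nat.cast_sum, Nat.cast_one, ← sum_neg_distrib]
    exact sum_congr rfl fun n hn => by rw [(mem_filter.1 hn).2]; simp
  have hcard : (((Icc 1 x).filter (fun n => f n = 1)).card : ℝ)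
      + ((Icc 1 x).filter (fun n => f n = -1)).card = x := by
    rw [← hneg]
    exact_mod_cast (card_filter_add_card_filter_not (s := Icc 1 x) (fun n => f n = 1)).trans
      (by simp)
  rw [← hsplit, h1, h2, abs_le]
  constructor <;> linarith

end Analytic

/-! ### Corollary 2.1 from the 99% Elliott bound for `λ` (Theorem 2.6 with `g_j = λ`) -/

section Reduction

/-- **Teräväinen 2024, Corollary 2.1 ⇐ Theorem 2.6 (`g_j = λ`), degree-truncated.** Suppose the
conclusion of Theorem 2.6 holds for `g₁ = ⋯ = g_k = λ` and every `1 ≤ k ≤ K`: for pairwise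
non-proportional forms `aᵢ n + bᵢ` (`aᵢ, bᵢ ≥ 1`) there is `δ > 0` with
`|∑_{n≤x} λ(a₁n+b₁)⋯λ(a_kn+b_k)| ≤ (1 − δ) x` for all large `x` (an `ε`-free rendering of
`limsup_x |(1/x)∑_{n≤x} ⋯| ≤ 1 − δ`). Then Corollary 2.1 holds for every non-square `P` of degree
`≤ K` splitting over `ℚ`: each sign `v = ±1` is taken by `λ(P(n))` for `≫_P x` integers `n ≤ x`.
Proof: the structure lemma `exists_linearForms_of_isNonSquarePoly` writes
`λ(P(n+N)) = ε ∏ᵢ λ(aᵢ n + bᵢ)` with `k ≤ deg P` forms; a `±1` sequence with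
`|∑_{n≤x}| ≤ (1−δ)x` takes each sign `≥ δx/2` times; shifting back by `N` costs a factor `2`.
This is the derivation "Corollary 2.1 follows as a special case" (§2.1) made explicit; with
`K → ∞` the hypothesis is exactly Theorem 2.6 for the Liouville function (which is admissible:
`𝔻(λ, χ; ∞) = ∞` for all `χ`, `LFunctions.Tao2016_liouvilleNonpretentious_holds`).
[cite: Teravainen2024, Corollary 2.1 and Theorem 2.6 (§2.1–2.2)] -/
theorem teravainen2024_cor_2_1_of_correlationBound (K : ℕ)
    (H : ∀ (k : ℕ) (a b : Fin k → ℕ), 1 ≤ k → k ≤ K → (∀ i, 1 ≤ a i) → (∀ i, 1 ≤ b i) →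
      (∀ i j, i ≠ j → a i * b j ≠ a j * b i) →
      ∃ δ : ℝ, 0 < δ ∧ ∃ x₀ : ℕ, ∀ x : ℕ, x₀ ≤ x →
        |∑ n ∈ Icc 1 x, ∏ i, (ArithmeticFunction.liouville (a i * n + b i) : ℝ)| ≤ (1 - δ) * x)
    (P : Polynomial ℤ) (hdeg : P.natDegree ≤ K) (hns : IsNonSquarePoly P)
    (hsp : FactorsIntoLinearFactorsOverRat P) (v : ℤ) (hv : v = 1 ∨ v = -1) :
    ∃ c : ℝ, 0 < c ∧ ∃ x₀ : ℕ, ∀ x : ℕ, x₀ ≤ x →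
      c * (x : ℝ) ≤ (((Finset.Icc 1 x).filter
        (fun n : ℕ => liouvilleInt (P.eval (n : ℤ)) = v)).card : ℝ) := by
  obtain ⟨k, a, b, ε, N, hk1, hkdeg, ha, hb, hab, hε, hid⟩ :=
    exists_linearForms_of_isNonSquarePoly hns hsp
  obtain ⟨δ, hδ, x₀, hx₀⟩ := H k a b hk1 (hkdeg.trans hdeg) ha hb hab
  -- the shifted sign sequence
  set f : ℕ → ℤ := fun n => ε * ∏ i, (ArithmeticFunction.liouville (a i * n + b i) : ℤ) with hf
  have hprod : ∀ n : ℕ, (∏ i, (ArithmeticFunction.liouville (a i * n + b i) : ℤ)) = 1 ∨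
      (∏ i, (ArithmeticFunction.liouville (a i * n + b i) : ℤ)) = -1 := by
    intro n
    have : IsUnit (∏ i, (ArithmeticFunction.liouville (a i * n + b i) : ℤ)) := by
      refine (prod_mem (S := IsUnit.submonoid ℤ) fun i _ => ?_)
      have hne : a i * n + b i ≠ 0 := by have := hb i; omega
      have := liouvilleInt_eq_one_or_eq_neg_one (m := ((a i * n + b i : ℕ) : ℤ)) (by exact_mod_cast hne)
      rw [liouvilleInt_natCast] at this
      rcases this with h | h <;> simp [IsUnit.mem_submonoid_iff, h]
    exact Int.isUnit_iff.1 this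
  have hf1 : ∀ n, 1 ≤ n → f n = 1 ∨ f n = -1 := by
    intro n _
    rcases hε with h | h <;> rcases hprod n with h' | h' <;> simp [hf, h, h']
  -- the 99% bound transfers to `f` (|ε| = 1)
  have hfsum : ∀ x : ℕ, x₀ ≤ x → |∑ n ∈ Icc 1 x, (f n : ℝ)| ≤ (1 - δ) * x := by
    intro x hx
    have h := hx₀ x hx
    have hεabs : |(ε : ℝ)| = 1 := by rcases hε with rfl | rfl <;> norm_num
    simp only [hf, Int.cast_mul, Int.cast_prod, ← mul_sum, abs_mul, hεabs, one_mul]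
    exact h
  -- density of the sign `v` for `f`
  have hdens : ∀ x : ℕ, x₀ ≤ x →
      δ * x / 2 ≤ ((Icc 1 x).filter (fun n => f n = v)).card := by
    intro x hx
    have h := hfsum x hx
    -- `∑ f = v (2 #E - x)`
    have hsplit := sum_filter_add_sum_filter_not (Icc 1 x) (fun n => f n = v) (fun n => (f n : ℝ))
    have hE : ∑ n ∈ (Icc 1 x).filter (fun n => f n = v), (f n : ℝ)
        = v * ((Icc 1 x).filter (fun n => f n = v)).card := by
      rw [card_eq_sum_ones, Nat.cast_sum, Nat.cast_one, mul_sum]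
      exact sum_congr rfl fun n hn => by rw [(mem_filter.1 hn).2]; simp
    have hE' : ∑ n ∈ (Icc 1 x).filter (fun n => ¬ f n = v), (f n : ℝ)
        = -v * ((Icc 1 x).filter (fun n => ¬ f n = v)).card := by
      rw [card_eq_sum_ones, Nat.cast_sum, Nat.cast_one, mul_sum]
      refine sum_congr rfl fun n hn => ?_
      have hn1 : 1 ≤ n := (mem_Icc.1 (mem_filter.1 hn).1).1
      rw [eq_neg_of_ne_of_sign (hf1 n hn1) hv (mem_filter.1 hn).2]
      simp
    have hcard : (((Icc 1 x).filter (fun n => f n = v)).card : ℝ)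
        + ((Icc 1 x).filter (fun n => ¬ f n = v)).card = x := by
      exact_mod_cast (card_filter_add_card_filter_not (s := Icc 1 x) (fun n => f n = v)).trans
        (by simp)
    rw [← hsplit, hE, hE'] at h
    have hvabs : |(v : ℝ)| = 1 := by rcases hv with rfl | rfl <;> norm_num
    have : |(v : ℝ) * (2 * ((Icc 1 x).filter (fun n => f n = v)).card - x)| ≤ (1 - δ) * x := by
      have := h
      calc |(v : ℝ) * (2 * ((Icc 1 x).filter (fun n => f n = v)).card - x)|
          = |(v : ℝ) * ((Icc 1 x).filter (fun n => f n = v)).card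
              + -v * ((Icc 1 x).filter (fun n => ¬ f n = v)).card| := by
            congr 1; rw [← hcard]; ring
        _ ≤ (1 - δ) * x := h
    rw [abs_mul, hvabs, one_mul, abs_le] at this
    linarith [this.1]
  -- shift back by `N`
  refine ⟨δ / 4, by positivity, max (x₀ + N) (2 * N), fun x hx => ?_⟩
  have hxN : N ≤ x := by omega
  have hx1 : x₀ ≤ x - N := by omega
  have hx2 : (x : ℝ) ≤ 2 * ((x - N : ℕ) : ℝ) := by
    have : 2 * N ≤ x := le_of_max_le_right hx
    have h' : x ≤ 2 * (x - N) := by omega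
    exact_mod_cast h'
  have hinj : ((Icc 1 (x - N)).filter (fun n => f n = v)).card
      ≤ ((Icc 1 x).filter (fun n : ℕ => liouvilleInt (P.eval (n : ℤ)) = v)).card := by
    apply card_le_card_of_injOn (fun n => n + N)
    · intro n hn
      rw [coe_filter, Set.mem_setOf_eq, mem_Icc] at hn ⊢
      obtain ⟨⟨hn1, hn2⟩, hfn⟩ := hn
      refine ⟨⟨?_, ?_⟩, ?_⟩
      · show 1 ≤ n + N
        omega
      · show n + N ≤ x
        omega
      · show liouvilleInt (P.eval ((n + N : ℕ) : ℤ)) = v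
        rw [show ((n + N : ℕ) : ℤ) = (n : ℤ) + N by push_cast; ring, hid n, ← hfn]
    · intro m _ n _ h
      simpa using h
  have hd := hdens (x - N) hx1
  calc δ / 4 * (x : ℝ) ≤ δ * ((x - N : ℕ) : ℝ) / 2 := by nlinarith
    _ ≤ ((Icc 1 (x - N)).filter (fun n => f n = v)).card := hd
    _ ≤ _ := by exact_mod_cast hinj

/-- **Teräväinen 2024, Corollary 2.1 ⇐ Theorem 2.6 for the Liouville function** (the printed
derivation, all degrees). If for every `k ≥ 1` and all pairwise non-proportional forms
`aᵢ n + bᵢ` (`aᵢ, bᵢ ≥ 1`) one has `|∑_{n≤x} λ(a₁n+b₁)⋯λ(a_kn+b_k)| ≤ (1 − δ)x` for some `δ > 0` and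
all large `x` — Theorem 2.6 with `g_j = λ`, `q = 2` (its hypothesis `𝔻(λ, χ; ∞) = ∞` holds, see
`LFunctions.Tao2016_liouvilleNonpretentious_holds`) — then the named fact
`teravainen2024_cor_2_1` holds. NOT a discharge: Theorem 2.6 (§5: entropy decrement, dense model
theorem, the 99% inverse theorem Prop. 5.3, Prop. 5.4 via Matomäki–Radziwiłł) is not in the tree.
[cite: Teravainen2024, §2.1 ("from which Corollary 2.1 follows as a special case") and Theorem 2.6] -/
theorem teravainen2024_cor_2_1_of_thm_2_6_liouville
    (H : ∀ (k : ℕ) (a b : Fin k → ℕ), 1 ≤ k → (∀ i, 1 ≤ a i) → (∀ i, 1 ≤ b i) →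
      (∀ i j, i ≠ j → a i * b j ≠ a j * b i) →
      ∃ δ : ℝ, 0 < δ ∧ ∃ x₀ : ℕ, ∀ x : ℕ, x₀ ≤ x →
        |∑ n ∈ Icc 1 x, ∏ i, (ArithmeticFunction.liouville (a i * n + b i) : ℝ)| ≤ (1 - δ) * x) :
    teravainen2024_cor_2_1 := fun P hns hsp v hv =>
  teravainen2024_cor_2_1_of_correlationBound P.natDegree
    (fun k a b hk _ ha hb hab => H k a b hk ha hb hab) P le_rfl hns hsp v hv

end Reduction

/-! ### At most two forms: Tao's two-point logarithmic Elliott theorem (unconditional) -/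

section TwoPoint

open Real Filter

/-- **The windowed two-point bound for `λ`** (Tao 2016, Theorem 1.3 with `g₁ = λ`, `ε = ¼`,
`ω = A` fixed): for `a₁, a₂ ≥ 1`, `a₁ b₂ ≠ a₂ b₁` and any `1`-bounded multiplicative `g₂`, there are
`ω ≥ 4` and `X₀` with `|∑_{x/ω<n≤x} λ(a₁n+b₁) g₂(a₂n+b₂)/n| ≤ ¼ log ω` for all integers `x ≥ X₀`.
The non-pretentiousness hypothesis (1.6) for `λ` is `LFunctions.Tao2016_liouvilleNonpretentious_holds`
and Theorem 1.3 is `LFunctions.tao_log_averaged_elliott_two_holds` (both proved in the tree).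
[cite: TaoFMP2016, Theorem 1.3] -/
theorem liouville_window_bound (a₁ a₂ b₁ b₂ : ℕ) (ha₁ : 1 ≤ a₁) (ha₂ : 1 ≤ a₂)
    (hab : a₁ * b₂ ≠ a₂ * b₁) (g₂ : ArithmeticFunction ℂ) (hg₂ : g₂.IsMultiplicative)
    (hg₂1 : ∀ n, ‖g₂ n‖ ≤ 1) :
    ∃ ω : ℝ, 4 ≤ ω ∧ ∃ X₀ : ℕ, ∀ x : ℕ, X₀ ≤ x → ω ≤ x ∧
      ‖∑ n ∈ Ioc ⌊(x : ℝ) / ω⌋₊ x,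
          (ArithmeticFunction.liouville : ArithmeticFunction ℂ) (a₁ * n + b₁) * g₂ (a₂ * n + b₂)
            / (n : ℂ)‖ ≤ (1 / 4) * Real.log ω := by
  obtain ⟨A₀, hA₀⟩ := LFunctions.tao_log_averaged_elliott_two_holds a₁ a₂ b₁ b₂ ha₁ ha₂ hab
    (1 / 4) (by norm_num)
  set A : ℝ := max A₀ 4 with hA
  have h1 : ∀ᶠ x : ℕ in atTop, ∀ (q : ℕ) (χ : DirichletCharacter ℂ q) (t : ℝ), 1 ≤ q →
      (q : ℝ) ≤ A → |t| ≤ A * (x : ℝ) →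
        A ≤ pretentiousDistSq (ArithmeticFunction.liouville : ArithmeticFunction ℂ)
          (twistedChar χ t) (x : ℝ) :=
    tendsto_natCast_atTop_atTop.eventually (LFunctions.Tao2016_liouvilleNonpretentious_holds A)
  have h2 : ∀ᶠ x : ℕ in atTop, A ≤ (x : ℝ) :=
    tendsto_natCast_atTop_atTop.eventually (eventually_ge_atTop A)
  obtain ⟨X₀, hX₀⟩ := eventually_atTop.1 (h1.and h2)
  refine ⟨A, le_max_right _ _, X₀, fun x hx => ⟨(hX₀ x hx).2, ?_⟩⟩
  have key := hA₀ A (le_max_left _ _) x A le_rfl (hX₀ x hx).2 _ g₂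
    LFunctions.isMultiplicative_liouville_complex hg₂ LFunctions.norm_liouville_complex_le_one
    hg₂1 (hX₀ x hx).1
  rwa [Nat.floor_natCast] at key

/-- From a log-window bound for a `±1`-valued `f` (at every large `x`, fixed `ω ≥ 4`) to the
99% mean bound `|∑_{n≤x} f(n)| ≤ (1 − δ)x` with `δ = 1/(4ω)`.
[cite: Teravainen2024, §5.1 (first paragraph: reduction to the logarithmic window bound)] -/
theorem correlationBound_of_window {f : ℕ → ℤ} (hf : ∀ n, 1 ≤ n → f n = 1 ∨ f n = -1)
    {ω : ℝ} (hω : 4 ≤ ω) {X₀ : ℕ}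
    (hwin : ∀ x : ℕ, X₀ ≤ x → ω ≤ x ∧
      |∑ n ∈ Ioc ⌊(x : ℝ) / ω⌋₊ x, (f n : ℝ) / n| ≤ (1 / 4) * Real.log ω) :
    ∃ δ : ℝ, 0 < δ ∧ ∃ x₀ : ℕ, ∀ x : ℕ, x₀ ≤ x →
      |∑ n ∈ Icc 1 x, (f n : ℝ)| ≤ (1 - δ) * x := by
  have hω0 : 0 < ω := by linarith
  refine ⟨2 * (1 / (8 * ω)), by positivity, X₀, fun x hx => ?_⟩
  obtain ⟨hωx, hw⟩ := hwin x hx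
  have hp := card_filter_ge_of_window_bound hf hω hωx hw (Or.inl rfl)
  have hm := card_filter_ge_of_window_bound hf hω hωx hw (Or.inr rfl)
  have hre : 1 / (8 * ω) * (x : ℝ) = x / (8 * ω) := by ring
  exact abs_sum_le_of_card_filter_ge hf (by rw [hre]; exact hp) (by rw [hre]; exact hm)

/-- **Two forms** (`k = 2` of Theorem 2.6 for `λ`, unconditionally): for `a₁, a₂, b₁, b₂ ≥ 1` with
`a₁ b₂ ≠ a₂ b₁`, `|∑_{n≤x} λ(a₁n+b₁)λ(a₂n+b₂)| ≤ (1 − δ)x` for some `δ > 0` and all large `x`; from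
Tao's Theorem 1.3 (`liouville_window_bound` with `g₂ = λ`) and the window-to-density transfer.
[cite: TaoFMP2016, Theorem 1.3 and Corollary 1.5] -/
theorem liouville_correlationBound_two (a₁ a₂ b₁ b₂ : ℕ) (ha₁ : 1 ≤ a₁) (ha₂ : 1 ≤ a₂)
    (hb₁ : 1 ≤ b₁) (hb₂ : 1 ≤ b₂) (hab : a₁ * b₂ ≠ a₂ * b₁) :
    ∃ δ : ℝ, 0 < δ ∧ ∃ x₀ : ℕ, ∀ x : ℕ, x₀ ≤ x →
      |∑ n ∈ Icc 1 x, (ArithmeticFunction.liouville (a₁ * n + b₁)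
        * ArithmeticFunction.liouville (a₂ * n + b₂) : ℝ)| ≤ (1 - δ) * x := by
  obtain ⟨ω, hω, X₀, hX⟩ := liouville_window_bound a₁ a₂ b₁ b₂ ha₁ ha₂ hab _
    LFunctions.isMultiplicative_liouville_complex LFunctions.norm_liouville_complex_le_one
  set f : ℕ → ℤ := fun n =>
    ArithmeticFunction.liouville (a₁ * n + b₁) * ArithmeticFunction.liouville (a₂ * n + b₂) with hf
  have hpm : ∀ m : ℕ, m ≠ 0 → ArithmeticFunction.liouville m = 1 ∨ ArithmeticFunction.liouville m = -1 :=
    fun m hm => by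
      have := liouvilleInt_eq_one_or_eq_neg_one (m := (m : ℤ)) (by exact_mod_cast hm)
      rwa [liouvilleInt_natCast] at this
  have hf1 : ∀ n, 1 ≤ n → f n = 1 ∨ f n = -1 := by
    intro n _
    rcases hpm (a₁ * n + b₁) (by omega) with h | h <;>
      rcases hpm (a₂ * n + b₂) (by omega) with h' | h' <;> simp [hf, h, h']
  have key := correlationBound_of_window hf1 hω (X₀ := X₀) (fun x hx => ⟨(hX x hx).1, by
    have h := (hX x hx).2
    have hcast : (∑ n ∈ Ioc ⌊(x : ℝ) / ω⌋₊ x,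
        (ArithmeticFunction.liouville : ArithmeticFunction ℂ) (a₁ * n + b₁)
          * (ArithmeticFunction.liouville : ArithmeticFunction ℂ) (a₂ * n + b₂) / (n : ℂ))
        = ((∑ n ∈ Ioc ⌊(x : ℝ) / ω⌋₊ x, (f n : ℝ) / n : ℝ) : ℂ) := by
      push_cast
      refine Finset.sum_congr rfl fun n _ => ?_
      simp only [ArithmeticFunction.intCoe_apply, hf, Int.cast_mul]
    rwa [hcast, Complex.norm_real, Real.norm_eq_abs] at h⟩)
  simpa [hf] using key

/-- **One form** (`k = 1`): for `a, b ≥ 1`, `|∑_{n≤x} λ(an+b)| ≤ (1 − δ)x` for some `δ > 0` and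
all large `x`; from Tao's Theorem 1.3 with `g₂ = 1` (the arithmetic function `ζ`) and the dummy
form `n + (b+1)`. (Of course this case is classical — the prime number theorem in progressions —
but the tree's Theorem 1.3 gives it in the same breath.) [cite: TaoFMP2016, Theorem 1.3] -/
theorem liouville_correlationBound_one (a b : ℕ) (ha : 1 ≤ a) (hb : 1 ≤ b) :
    ∃ δ : ℝ, 0 < δ ∧ ∃ x₀ : ℕ, ∀ x : ℕ, x₀ ≤ x →
      |∑ n ∈ Icc 1 x, (ArithmeticFunction.liouville (a * n + b) : ℝ)| ≤ (1 - δ) * x := by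
  have hab : a * (b + 1) ≠ 1 * b := by
    intro h; nlinarith
  have hz1 : ∀ n, ‖(ArithmeticFunction.zeta : ArithmeticFunction ℂ) n‖ ≤ 1 := by
    intro n
    rw [ArithmeticFunction.natCoe_apply, ArithmeticFunction.zeta_apply]
    split_ifs <;> simp
  obtain ⟨ω, hω, X₀, hX⟩ := liouville_window_bound a 1 b (b + 1) ha le_rfl hab
    (ArithmeticFunction.zeta : ArithmeticFunction ℂ) ArithmeticFunction.isMultiplicative_zeta.natCast hz1
  set f : ℕ → ℤ := fun n => ArithmeticFunction.liouville (a * n + b) with hf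
  have hf1 : ∀ n, 1 ≤ n → f n = 1 ∨ f n = -1 := by
    intro n _
    have := liouvilleInt_eq_one_or_eq_neg_one (m := ((a * n + b : ℕ) : ℤ)) (by
      have : a * n + b ≠ 0 := by omega
      exact_mod_cast this)
    rwa [liouvilleInt_natCast] at this
  have key := correlationBound_of_window hf1 hω (X₀ := X₀) (fun x hx => ⟨(hX x hx).1, by
    have h := (hX x hx).2
    have hcast : (∑ n ∈ Ioc ⌊(x : ℝ) / ω⌋₊ x,
        (ArithmeticFunction.liouville : ArithmeticFunction ℂ) (a * n + b)
          * (ArithmeticFunction.zeta : ArithmeticFunction ℂ) (1 * n + (b + 1)) / (n : ℂ))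
        = ((∑ n ∈ Ioc ⌊(x : ℝ) / ω⌋₊ x, (f n : ℝ) / n : ℝ) : ℂ) := by
      push_cast
      refine Finset.sum_congr rfl fun n _ => ?_
      have hz : (ArithmeticFunction.zeta : ArithmeticFunction ℂ) (1 * n + (b + 1)) = 1 := by
        rw [ArithmeticFunction.natCoe_apply, ArithmeticFunction.zeta_apply, if_neg (by omega)]
        simp
      simp only [ArithmeticFunction.intCoe_apply, hf, hz, mul_one]
    rwa [hcast, Complex.norm_real, Real.norm_eq_abs] at h⟩)
  simpa [hf] using key

/-- **Theorem 2.6 for `λ` with `k ≤ 2` forms, unconditionally** (Tao 2016): the hypothesis of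
`teravainen2024_cor_2_1_of_correlationBound` with `K = 2`.
[cite: TaoFMP2016, Theorem 1.3 and Corollary 1.5] -/
theorem liouville_correlationBound_of_le_two (k : ℕ) (a b : Fin k → ℕ) (hk1 : 1 ≤ k)
    (hk2 : k ≤ 2) (ha : ∀ i, 1 ≤ a i) (hb : ∀ i, 1 ≤ b i)
    (hab : ∀ i j, i ≠ j → a i * b j ≠ a j * b i) :
    ∃ δ : ℝ, 0 < δ ∧ ∃ x₀ : ℕ, ∀ x : ℕ, x₀ ≤ x →
      |∑ n ∈ Icc 1 x, ∏ i, (ArithmeticFunction.liouville (a i * n + b i) : ℝ)| ≤ (1 - δ) * x := by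
  obtain rfl | rfl : k = 1 ∨ k = 2 := by omega
  · simp only [Fin.prod_univ_one]
    exact liouville_correlationBound_one (a 0) (b 0) (ha 0) (hb 0)
  · simp only [Fin.prod_univ_two]
    exact liouville_correlationBound_two (a 0) (a 1) (b 0) (b 1) (ha 0) (ha 1) (hb 0) (hb 1)
      (hab 0 1 (by decide))

/-- **Teräväinen 2024, Corollary 2.1 for `deg P ≤ 2` — PROVED unconditionally.** For every
non-square `P ∈ ℤ[x]` of degree at most `2` that splits into linear factors over `ℚ` (so
`P = c(a₁x+b₁)`, `c(a₁x+b₁)(a₂x+b₂)` with non-proportional factors, up to the conventions of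
Definition 1.1) and either sign `v ∈ {−1,+1}`, the number of `n ≤ x` with `λ(P(n)) = v` is `≫_P x`.
Assembled from the structure lemma, the window-to-density transfer (§5.1 of the paper) and Tao's
two-point logarithmic Elliott theorem (the `k ≤ 2` cases of Theorem 2.6 for `λ`,
`liouville_correlationBound_of_le_two`). The general case (`k ≥ 3` odd-multiplicity roots) is the
named fact `teravainen2024_cor_2_1`, equivalent by `teravainen2024_cor_2_1_of_thm_2_6_liouville`
to supplying Theorem 2.6 for `λ`. [cite: Teravainen2024, Corollary 2.1 (case deg P ≤ 2)] -/
theorem teravainen2024_cor_2_1_of_natDegree_le_two (P : Polynomial ℤ) (hdeg : P.natDegree ≤ 2)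
    (hns : IsNonSquarePoly P) (hsp : FactorsIntoLinearFactorsOverRat P) (v : ℤ)
    (hv : v = 1 ∨ v = -1) :
    ∃ c : ℝ, 0 < c ∧ ∃ x₀ : ℕ, ∀ x : ℕ, x₀ ≤ x →
      c * (x : ℝ) ≤ (((Finset.Icc 1 x).filter
        (fun n : ℕ => liouvilleInt (P.eval (n : ℤ)) = v)).card : ℝ) :=
  teravainen2024_cor_2_1_of_correlationBound 2
    (fun k a b hk hk2 ha hb hab => liouville_correlationBound_of_le_two k a b hk hk2 ha hb hab)
    P hdeg hns hsp v hv

end TwoPoint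

/-! ### The first reduction of §5.1: log-window means control natural means -/

section Transfer

open Real

/-- **Teräväinen 2024, §5.1, first reduction (first paragraph of §5.1), clean form.** Let `F : ℕ → ℂ` be
`1`-bounded, `8 ≤ ω ≤ x`, `0 ≤ η`, and suppose the logarithmic mean of `F` on the window
`x/ω < n ≤ x` is at most `1 − η` in modulus:
`‖∑_{x/ω<n≤x} F(n)/n‖ ≤ (1 − η) ∑_{x/ω<n≤x} 1/n`. Then `‖∑_{n≤x} F(n)‖ ≤ (1 − η/ω) x`.
(Printed: "if `|𝔼^log_{x/ω≤n≤x} F| ≤ 1 − η` for all large `x`, then ... `|𝔼_{n≤x} F| ≤ 1 − η²/ω`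
for all large `x`"; the proof here — if the natural mean is `> 1 − η/ω` in modulus then, after
rotating, `∑_{n≤x} (1 − Re F(n)) < ηx/ω`, so the window defect `∑ (1 − Re F(n))/n` is `< η`, while the
hypothesis forces it to be `≥ η H` with `H = ∑_{x/ω<n≤x} 1/n ≥ log(ω/2) > 1` — gives the constant
`η/ω`.) [cite: Teravainen2024, §5.1 (first paragraph: reduction to the logarithmic window bound)] -/
theorem norm_sum_le_of_logWindow_le {F : ℕ → ℂ} (hF : ∀ n, ‖F n‖ ≤ 1) {ω : ℝ} (hω : 8 ≤ ω)
    {x : ℕ} (hωx : ω ≤ x) {η : ℝ} (hη : 0 ≤ η)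
    (hwin : ‖∑ n ∈ Ioc ⌊(x : ℝ) / ω⌋₊ x, F n / (n : ℂ)‖
      ≤ (1 - η) * ∑ n ∈ Ioc ⌊(x : ℝ) / ω⌋₊ x, (1 : ℝ) / n) :
    ‖∑ n ∈ Icc 1 x, F n‖ ≤ (1 - η / ω) * x := by
  by_contra hlt
  push Not at hlt
  set M := ⌊(x : ℝ) / ω⌋₊ with hM
  set S : ℂ := ∑ n ∈ Icc 1 x, F n with hS
  set H : ℝ := ∑ n ∈ Ioc M x, (1 : ℝ) / n with hH
  have hω0 : (0 : ℝ) < ω := by linarith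
  have hx0 : (0 : ℝ) < x := by linarith
  have hMlt : (x : ℝ) / ω < (M : ℝ) + 1 := Nat.lt_floor_add_one _
  have hMle : (M : ℝ) ≤ (x : ℝ) / ω := Nat.floor_le (by positivity)
  have hMx : M ≤ x := by
    have : (M : ℝ) ≤ x := hMle.trans (div_le_self hx0.le (by linarith))
    exact_mod_cast this
  -- `H > 1`
  have hH1 : 1 < H := by
    have h1 := log_sub_log_le_sum_Ioc_inv hMx
    have hlog2 : (1 : ℝ) / 2 < Real.log 2 := by
      have := Real.log_two_gt_d9; norm_num at this ⊢; linarith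
    have hlog4 : 1 < Real.log 4 := by
      rw [show (4 : ℝ) = 2 ^ 2 by norm_num, Real.log_pow]; push_cast; linarith
    have h2 : Real.log 4 ≤ Real.log ((x : ℝ) + 1) - Real.log ((M : ℝ) + 1) := by
      rw [← Real.log_div (by positivity) (by positivity)]
      apply Real.log_le_log (by norm_num)
      rw [le_div_iff₀ (by positivity)]
      have : ω * ((M : ℝ) + 1) ≤ x + ω := by
        have := mul_le_mul_of_nonneg_left hMle hω0.le
        rw [mul_div_cancel₀ _ hω0.ne'] at this
        linarith
      nlinarith
    linarith
  -- rotate: `u = conj(S)/‖S‖`, `G n = Re(u F n) ≤ 1`, `∑_{n≤x} G = ‖S‖`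
  have hS0 : S ≠ 0 := by
    intro h0
    rw [h0, norm_zero] at hlt
    have : (1 - η / ω) * (x : ℝ) < 0 := hlt
    have h2 : η / ω ≤ η / 8 := div_le_div_of_nonneg_left hη (by norm_num) hω
    -- `‖window sum‖ ≥ 0` forces `(1 - η) H ≥ 0`, so `η ≤ 1`
    have h3 : 0 ≤ (1 - η) * H := (norm_nonneg _).trans hwin
    have h4 : η ≤ 1 := by
      by_contra h5
      push Not at h5
      have : (1 - η) * H < 0 := mul_neg_of_neg_of_pos (by linarith) (by linarith)
      linarith
    nlinarith
  set u : ℂ := (starRingEnd ℂ) S / (‖S‖ : ℂ) with hu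
  have hSn : (0 : ℝ) < ‖S‖ := norm_pos_iff.2 hS0
  have hu1 : ‖u‖ = 1 := by
    rw [hu, norm_div, Complex.norm_conj, Complex.norm_real, Real.norm_of_nonneg hSn.le,
      div_self hSn.ne']
  have huS : u * S = (‖S‖ : ℂ) := by
    rw [hu, div_mul_eq_mul_div, Complex.conj_mul', div_eq_iff (by exact_mod_cast hSn.ne')]
    ring
  set G : ℕ → ℝ := fun n => (u * F n).re with hG
  have hG1 : ∀ n, G n ≤ 1 := fun n => by
    have := Complex.re_le_norm (u * F n)
    rw [norm_mul, hu1, one_mul] at this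
    exact this.trans (hF n)
  have hGsum : ∑ n ∈ Icc 1 x, G n = ‖S‖ := by
    have : (u * S).re = ‖S‖ := by rw [huS]; simp
    rw [← this, hS, mul_sum, Complex.re_sum]
  -- the total defect is `< η x / ω`
  have hdef : ∑ n ∈ Icc 1 x, (1 - G n) < η / ω * x := by
    rw [sum_sub_distrib, sum_const, Nat.card_Icc, hGsum]
    simp only [add_tsub_cancel_right, nsmul_eq_mul, mul_one]
    linarith
  -- the window defect is `< η`
  have hwdef : ∑ n ∈ Ioc M x, (1 - G n) / n < η := by
    have hsub : Ioc M x ⊆ Icc 1 x := fun n hn => by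
      rw [mem_Ioc] at hn; exact mem_Icc.2 ⟨by omega, hn.2⟩
    have h1 : ∑ n ∈ Ioc M x, (1 - G n) / n ≤ ∑ n ∈ Ioc M x, (1 - G n) * (ω / x) := by
      apply sum_le_sum
      intro n hn
      have hn' : (M : ℝ) + 1 ≤ n := by exact_mod_cast (mem_Ioc.1 hn).1
      have hnpos : (0 : ℝ) < n := by linarith
      rw [div_eq_mul_one_div]
      apply mul_le_mul_of_nonneg_left _ (by linarith [hG1 n])
      rw [div_le_div_iff₀ hnpos hx0, one_mul]
      rw [div_lt_iff₀ hω0] at hMlt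
      nlinarith
    have h2 : ∑ n ∈ Ioc M x, (1 - G n) * (ω / x) ≤ ∑ n ∈ Icc 1 x, (1 - G n) * (ω / x) :=
      sum_le_sum_of_subset_of_nonneg hsub fun n _ _ =>
        mul_nonneg (by linarith [hG1 n]) (by positivity)
    calc ∑ n ∈ Ioc M x, (1 - G n) / n ≤ ∑ n ∈ Icc 1 x, (1 - G n) * (ω / x) := h1.trans h2
      _ = (∑ n ∈ Icc 1 x, (1 - G n)) * (ω / x) := by rw [sum_mul]
      _ < η / ω * x * (ω / x) := by gcongr
      _ = η := by field_simp
  -- but the hypothesis forces it to be `≥ η H`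
  have hwre : ∑ n ∈ Ioc M x, G n / n ≤ (1 - η) * H := by
    have : (u * ∑ n ∈ Ioc M x, F n / (n : ℂ)).re = ∑ n ∈ Ioc M x, G n / n := by
      rw [mul_sum, Complex.re_sum]
      refine sum_congr rfl fun n _ => ?_
      rw [hG, ← mul_div_assoc, Complex.div_natCast_re]
    rw [← this]
    refine (Complex.re_le_norm _).trans ?_
    rw [norm_mul, hu1, one_mul]
    exact hwin
  have hsplit : ∑ n ∈ Ioc M x, (1 - G n) / n = H - ∑ n ∈ Ioc M x, G n / n := by
    rw [hH, ← sum_sub_distrib]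
    exact sum_congr rfl fun n _ => by ring
  rw [hsplit] at hwdef
  -- `H - (1-η) H ≤ H - ∑ G/n < η` gives `η H < η`, contradicting `H > 1` (if `η > 0`) or trivial
  have : η * H < η := by linarith
  rcases hη.lt_or_eq with hη' | hη'
  · have : H < 1 := by
      by_contra h; push Not at h; nlinarith
    linarith
  · rw [← hη'] at this; simp at this

end Transfer

end Literature.NumberTheory.Sieve
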